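import Mathlib
import Literature.Analysis.FluidPDE.Tao2016AveragedNS.ShiftSetCascadeFlows
import Summits.NavierStokesRegularity.NavierStokesRegularity.Theorems.TaoLadderRungTwoFlatCertificateGlueCheckerVectorOn
import Summits.NavierStokesRegularity.NavierStokesRegularity.Theorems.TaoLadderRungTwoFlatCertificateGlueJacobianVarMatOn
import HarnessLib

/-!
# Certificate glue on a shift set `𝕊`, XXXVIII-i: ONE FAT DIRECTION OVER THE SPARSE JACOBIANS — `varVecStepA` / `varVecLevelsA` (the variational levels
  of a single direction box, propagated through the Jacobian tables of glue XXXVIII-b/c instead of `2(k+1)` field evaluations per level),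
  `mem_varVecLevelsA`, and the remainder-direction bound `nveArrJ` with `abs_VPoly_le_nveArrJ` (twin of glue XXVI-b `abs_VPoly_le_nveArr`)
  (helper for items stmt-NavierStokesRegularity-22987 `FlatGapCertificatesV2` (crux K_A♭ of route TaoLadderRungTwoFlat) and stmt-24295 K_A₂(64);
  cell harvest/h2-tao-ladder, p1 g18; PERFORMANCE: the NVE column of `checkStepGJ` costs ≈ 30 s of its ≈ 200 s at n = 98, p = 16 — here ≈ 2 s)

HONEST FRAMING: Tao-type MODEL lattices (Tao 2016 §4/§6 vocabulary, shift-set parametrised); interval-arithmetic soundness — no certificate data, nothing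
certified, no stub closed, nothing here is a statement about the Navier–Stokes equations.
-/

-- the sub-problem namespace repeats the summit name by design (D-0017)
set_option linter.dupNamespace false

namespace Summit.NavierStokesRegularity.NavierStokesRegularity.Theorems

open Set Finset Literature.Analysis.FluidPDE Literature.Analysis.FluidPDE.TaoCascade
open Summit.NavierStokesRegularity.NavierStokesRegularity.Theorems.TaylorModelCert
open Summit.NavierStokesRegularity.NavierStokesRegularity.Theorems.TaylorModelReadout

namespace CertificateGlueOn

/-! ### One direction: the executable side -/

/-- Level `k+1` of the variational levels of ONE direction from levels `0..k` (`Us`), through the Jacobian rows `Js[i]` of the state levels: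
`V_{k+1}[c] = (Σ_{i≤k} Σ_{(e,B) ∈ J_i[c]} B ⊗ V_{k−i}[e]) / (k+1)`. [folklore] -/
def varVecStepA (n prec : ℕ) (Js : Array (Array (List (ℕ × IntervalD)))) (k : ℕ) (Us : Array (Array IntervalD)) : Array IntervalD :=
  Array.ofFn fun c : Fin n =>
    IntervalD.divNat prec
      (IntervalD.rangeSumR prec (fun i => rowApply prec (fun e => IntervalD.aget (IntervalD.lget Us (k - i)) e) (jrow Js i c.val)) (k + 1)) (k + 1)

/-- The variational levels `0..K` of the direction box `D` through the Jacobian tables. [folklore] -/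
def varVecLevelsA (n prec : ℕ) (Js : Array (Array (List (ℕ × IntervalD)))) (D : Array IntervalD) : ℕ → Array (Array IntervalD) :=
  IntervalD.buildLevels (varVecStepA n prec Js) D

/-! ### Soundness -/

/-- **THE ONE-DIRECTION TABLE ENCLOSES THE VARIATIONAL JETS**: if `Jf` is a sparse interval Jacobian of `Q`, the state levels `Ls` enclose `T y i` (`i ≤ K`)
and `D` encloses the direction `v`, then `U y v k c ∈ V_k[c]` for `k ≤ K`. [cite: Zgliczynski2002C1Lohner, §3–4 (the variational part); cell certificate format, checker clauses] -/
theorem mem_varVecLevelsA {n : ℕ} {Q : (Fin n → ℝ) → (Fin n → ℝ) → Fin n → ℝ} {Jf : Array IntervalD → Array (List (ℕ × IntervalD))}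
    (hJ : IsJacEnclosureA Q Jf) (prec K : ℕ) {Ls : Array (Array IntervalD)} {y : Fin n → ℝ}
    (hT : ∀ i ≤ K, ∀ c < n, IntervalD.mem (rdN (taylorJet Q y i) c) (IntervalD.aget (IntervalD.lget Ls i) c))
    {D : Array IntervalD} {v : Fin n → ℝ} (hv : ∀ c < n, IntervalD.mem (rdN v c) (IntervalD.aget D c)) :
    ∀ k ≤ K, ∀ c < n, IntervalD.mem (rdN (varJet Q y v k) c) (IntervalD.aget (IntervalD.lget (varVecLevelsA n prec (jacLevelsA Jf Ls K) D K) k) c) := by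
  intro k
  induction k using Nat.strong_induction_on with
  | _ k ih =>
    intro hk c hc
    cases k with
    | zero =>
      unfold varVecLevelsA
      rw [IntervalD.lget_buildLevels_zero, varJet_zero]
      exact hv c hc
    | succ k =>
      unfold varVecLevelsA
      rw [IntervalD.lget_buildLevels_of_le _ D hk, IntervalD.lget_buildLevels_succ]
      unfold varVecStepA
      rw [IntervalD.aget_ofFn _ hc, rdN_of_lt _ hc]
      dsimp only
      have hrec := varJet_succ_apply Q y v k ⟨c, hc⟩
      have e : varJet Q y v (k + 1) ⟨c, hc⟩ =
          (∑ i ∈ Finset.range (k + 1), (Q (taylorJet Q y i) (varJet Q y v (k - i)) ⟨c, hc⟩ +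
            Q (varJet Q y v (k - i)) (taylorJet Q y i) ⟨c, hc⟩)) / ((k + 1 : ℕ) : ℝ) := by
        rw [eq_div_iff (by positivity), Nat.cast_succ, mul_comm]
        exact hrec
      rw [e]
      refine IntervalD.mem_divNat prec (IntervalD.mem_rangeSumR prec (k + 1) fun i hi => ?_) (Nat.succ_pos k)
      have hiK : i ≤ K := by omega
      obtain ⟨σ, hok, hproj, hbd, hval⟩ := hJ (IntervalD.lget Ls i) (taylorJet Q y i) (hT i hiK) ⟨c, hc⟩
      have hrow : jrow (jacLevelsA Jf Ls K) i c = projRow σ := by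
        unfold jrow jacLevelsA
        rw [tget_ofFn _ (by omega : i < K + 1), hproj]
      rw [hrow, hval]
      refine mem_rowApply prec hok fun t ht => ?_
      have htn := hbd t ht
      have hki : k - i < k + 1 := by omega
      have h := ih (k - i) hki (by omega) t.1 htn
      unfold varVecLevelsA at h
      rw [IntervalD.lget_buildLevels_of_le _ D (by omega : k - i ≤ K)] at h
      rw [IntervalD.lget_buildLevels_of_le _ D (Nat.sub_le k i)]
      exact h

/-! ### The remainder-direction bound through the Jacobians -/

variable {m : ℕ} {Kb Ka : ℤ} {ω : Fin m → ℤ → ℝ} {ε₀ : ℝ} {α : Fin m → Fin m → Fin m → ℤ × ℤ × ℤ → ℝ}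
  {shifts : List (ℤ × ℤ × ℤ)} {prec : ℕ} {coefB : Fin m → ℤ → Fin m → Fin m → ℤ × ℤ × ℤ → IntervalD}

/-- **`VPoly` IS ENCLOSED along a direction box, Jacobian form** (twin of glue XXVI `mem_VPoly_polyLevels`): for `x ∈ X`, `v ∈ D` and `u ∈ H`,
`VPoly (PQcN …) p x v u c ∈ (polyLevelsA n prec (varVecLevelsA n prec (jacLevelsA pqJacA JETS p) D p) p H)[c]` with `JETS = jetLevelsA n pqBoxA prec X p`.
[cite: Zgliczynski2002C1Lohner, §3–4 (the variational part); cell certificate format, checker clauses] -/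
theorem mem_VPoly_polyLevelsJ (hKb : 0 ≤ Kb) (hKa : 1 ≤ Ka) (hnd : shifts.Nodup) (hcoef : CoefBoxOK shifts ε₀ α Kb Ka ω coefB) (p : ℕ)
    {X D : Array IntervalD} (hX : X.size = m * winLen Kb Ka) {x v : Fin (m * winLen Kb Ka) → ℝ}
    (hx : ∀ c < m * winLen Kb Ka, IntervalD.mem (rdN x c) (IntervalD.aget X c))
    (hv : ∀ c < m * winLen Kb Ka, IntervalD.mem (rdN v c) (IntervalD.aget D c)) {H : IntervalD} {u : ℝ} (hu : IntervalD.mem u H) :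
    ∀ c < m * winLen Kb Ka, IntervalD.mem (rdN (VPoly (PQcN shifts.toFinset ε₀ α Kb Ka ω) p x v u) c)
      (IntervalD.aget (IntervalD.polyLevelsA (m * winLen Kb Ka) prec
        (varVecLevelsA (m * winLen Kb Ka) prec (jacLevelsA (pqJacA Kb Ka prec shifts coefB)
          (IntervalD.jetLevelsA (m * winLen Kb Ka) (pqBoxA Kb Ka prec shifts coefB) prec X p) p) D p) p H) c) := by
  have hjets := mem_varVecLevelsA (Q := PQcN shifts.toFinset ε₀ α Kb Ka ω) (isJacEnclosureA_pqJacA (prec := prec) hKb hKa hnd hcoef) prec p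
    (Ls := IntervalD.jetLevelsA (m * winLen Kb Ka) (pqBoxA Kb Ka prec shifts coefB) prec X p) (y := x)
    (mem_taylorJet_pqLevels (prec := prec) hKb hKa hnd hcoef p hX hx) (D := D) (v := v) hv
  intro c hc
  rw [rdN_of_lt _ hc]
  have h := IntervalD.mem_polyLevelsA prec (a := fun k c => rdN (varJet (PQcN shifts.toFinset ε₀ α Kb Ka ω) x v k) c) hjets hu c hc
  simp only [rdN_of_lt _ hc] at h
  exact h

/-- **THE REMAINDER-DIRECTION BOUND, JACOBIAN FORM** (twin of glue XXVI-b `abs_VPoly_le_nveArr`): for every `z` in the hull box and `e` in `[−E, E]`,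
`|VPoly(z)(e)_c| ≤ NVE_c` where `NVE = nveArr` of the one-direction table over the hull-jet Jacobians with the direction box `symBoxA E`.
[cite: Zgliczynski2002C1Lohner, §3–4 (the variational part); cell certificate format, checker clauses] -/
theorem abs_VPoly_le_nveArrJ (hKb : 0 ≤ Kb) (hKa : 1 ≤ Ka) (hnd : shifts.Nodup) (hcoef : CoefBoxOK shifts ε₀ α Kb Ka ω coefB) (p : ℕ)
    (xD ρD ED : Array Dyad) {H : IntervalD} {u : ℝ} (hu : IntervalD.mem u H) :
    ∀ z : Fin (m * winLen Kb Ka) → ℝ,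
      (∀ d, |z d - dvec (n := m * winLen Kb Ka) xD d| ≤ dvec (n := m * winLen Kb Ka) ρD d + dvec (n := m * winLen Kb Ka) ED d) →
      ∀ e : Fin (m * winLen Kb Ka) → ℝ, (∀ c, |e c| ≤ dvec (n := m * winLen Kb Ka) ED c) →
      ∀ c, |VPoly (PQcN shifts.toFinset ε₀ α Kb Ka ω) p z e u c| ≤
        (dgetD (nveArr (m * winLen Kb Ka) (IntervalD.polyLevelsA (m * winLen Kb Ka) prec
          (varVecLevelsA (m * winLen Kb Ka) prec (jacLevelsA (pqJacA Kb Ka prec shifts coefB)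
            (IntervalD.jetLevelsA (m * winLen Kb Ka) (pqBoxA Kb Ka prec shifts coefB) prec (hullBoxA (m * winLen Kb Ka) xD ρD ED) p) p)
            (symBoxA (m * winLen Kb Ka) ED) p) p H)) c).toReal := by
  intro z hz e he c
  rw [dgetD_nveArr]
  have hm := mem_VPoly_polyLevelsJ (prec := prec) hKb hKa hnd hcoef p (by simp [hullBoxA]) (mem_hullBoxA xD ρD ED hz) (mem_symBoxA ED he) hu c c.isLt
  rw [rdN_of_lt _ c.isLt] at hm
  exact IntervalD.abs_le_mag hm

end CertificateGlueOn

end Summit.NavierStokesRegularity.NavierStokesRegularity.Theorems
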